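import Summits.AtomisticToContinuum.Crystallization.Theorems.FreeSplittingCertificatesStrictSplittingRuleTorusModelDualSum

/-!
# The DUAL side with the two κ-constants scaled SEPARATELY (κ₁: radial stretches, κ₃: recentred rotations)

Route `FreeSplittingCertificates`, crux `StrictSplittingRule` (stmt-AtomisticToContinuum-12560); unit b2b-freesplit-B (block 2b,
PART B, gen 2).  **VALUE = theorems about FINITE models — NOT summit progress.**

`…TorusModelDualSum.lean` scales the whole κ-demand `K_p = κ₁Σ⟨V s, e_s⟩² + κ₃Σ‖e_s − W V s‖²` by one factor `λ`.  The line's budget question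
(H3-SCOPE: "κ₃ is the expensive constant") asks for the two constants separately.  This file splits the κ-demand term list of
`…TorusModelGen` into its κ₁ part `kappa1S` and its κ₃ part `kappa3S` (`kappaS_eq_add : kappaS = kappa1S + kappa3S`), defines the
two-parameter site balance `siteBalance2 λ₁ λ₃ p u = S_p + meanProj − λ₁K¹_p − λ₃K³_p − R_p`, proves the weak duality
`not_jointLMI2_of_siteSum_neg` (a negative site sum defeats every zero-sum transfer family for the `(λ₁, λ₃)`-scaled demand) and the
proved-correct evaluator `torusBalance2` (`torusBalance2_eq`).  Instances: `…TorusModel663DualSplit.lean`. [folklore: weak LP duality]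
-/

namespace Summit.AtomisticToContinuum.Crystallization.Theorems.StrictSplittingRuleTorusLMI

open Literature.Computation.Certificates

/-- Sum of a pointwise sum of two maps over a list. [folklore] -/
private theorem sum_map_add' {α : Type*} (l : List α) (f g : α → ℚ) :
    (l.map fun a => f a + g a).sum = (l.map f).sum + (l.map g).sum := by
  induction l with
  | nil => simp
  | cons a l ih => simp only [List.map_cons, List.sum_cons, ih]; ring

section Shape

variable (NK N1 : ℕ) [NeZero NK] [NeZero N1]

/-- κ₁ part of the demand terms at `p`: `κ₁⟨V s, e_s⟩²_G` over the 12 shell sites. [folklore] -/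
def kappa1TermsG (p : SiteG NK N1) : List (Term (dimG NK N1)) :=
  let b := parityG NK N1 p
  (shell b).flatMap fun s =>
    let y := V b s
    let q := taddG NK N1 p s
    [sqN kappa1 (dotGN y fun c => eRelG NK N1 p q c)]

/-- κ₃ part of the demand terms at `p`: `κ₃·g_c·(e_s − W V s)_c²` over the 12 shell sites. [folklore] -/
def kappa3TermsG (p : SiteG NK N1) (ths : List (LinF (dimG NK N1))) : List (Term (dimG NK N1)) :=
  let b := parityG NK N1 p
  (shell b).flatMap fun s =>
    let y := V b s
    let q := taddG NK N1 p s
    [sqN (kappa3 * gW 0) (residG NK N1 ths p q y 0), sqN (kappa3 * gW 1) (residG NK N1 ths p q y 1),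
      sqN (kappa3 * gW 2) (residG NK N1 ths p q y 2)]

/-- κ₁-DEMAND `K¹_p(u) = κ₁Σ⟨V s, e_s⟩²` (`κ₁ = 1/3`). [folklore] -/
def kappa1S (p : SiteG NK N1) (u : Fin (dimG NK N1) → ℚ) : ℚ := evalQ (kappa1TermsG NK N1 p) u
/-- κ₃-DEMAND `K³_p(u) = κ₃Σ‖e_s − W V s‖²` (`κ₃ = 1/12`). [folklore] -/
def kappa3S (p : SiteG NK N1) (u : Fin (dimG NK N1) → ℚ) : ℚ := evalQ (kappa3TermsG NK N1 p (thetaListG NK N1 p)) u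

/-- **The κ-demand splits**: `kappaS = kappa1S + kappa3S`. [folklore] -/
theorem kappaS_eq_add (p : SiteG NK N1) (u : Fin (dimG NK N1) → ℚ) :
    kappaS NK N1 p u = kappa1S NK N1 p u + kappa3S NK N1 p u := by
  simp only [kappaS, kappaTermsG, kappa1S, kappa1TermsG, kappa3S, kappa3TermsG, evalQ_flatMapN, ← sum_map_add']
  congr 1
  refine List.map_congr_left fun s _ => ?_
  simp only [evalQ_cons, evalQ_nil]
  ring

/-- Two-parameter transfer-free SITE BALANCE: `S_p + meanProj − λ₁K¹_p − λ₃K³_p − R_p`. [folklore] -/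
def siteBalance2 (lam1 lam3 : ℚ) (p : SiteG NK N1) (u : Fin (dimG NK N1) → ℚ) : ℚ :=
  supplyS NK N1 p u + meanProjS NK N1 u - lam1 * kappa1S NK N1 p u - lam3 * kappa3S NK N1 p u - readoutS NK N1 p u

/-- Consistency: equal scalings give back `siteBalance`. [folklore] -/
theorem siteBalance2_self (lam : ℚ) (p : SiteG NK N1) (u : Fin (dimG NK N1) → ℚ) :
    siteBalance2 NK N1 lam lam p u = siteBalance NK N1 lam p u := by
  simp only [siteBalance2, siteBalance, kappaS_eq_add]
  ring

/-- **Weak duality, two scalings**: a negative two-parameter site sum defeats every transfer assignment with zero site sum. [folklore] -/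
theorem exists_deficit2_of_siteSum_neg (lam1 lam3 : ℚ) (u : Fin (dimG NK N1) → ℚ)
    (T : SiteG NK N1 → (Fin (dimG NK N1) → ℚ) → ℚ) (hT : ∑ p, T p u = 0)
    (hneg : ∑ p, siteBalance2 NK N1 lam1 lam3 p u < 0) :
    ∃ p : SiteG NK N1, supplyS NK N1 p u + T p u + meanProjS NK N1 u <
      lam1 * kappa1S NK N1 p u + lam3 * kappa3S NK N1 p u + readoutS NK N1 p u := by
  have h1 : ∑ p, (supplyS NK N1 p u + T p u + meanProjS NK N1 u) = ∑ p, siteBalance2 NK N1 lam1 lam3 p u +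
      ∑ p, (lam1 * kappa1S NK N1 p u + lam3 * kappa3S NK N1 p u + readoutS NK N1 p u) + ∑ p, T p u := by
    rw [← Finset.sum_add_distrib, ← Finset.sum_add_distrib]
    refine Finset.sum_congr rfl fun p _ => ?_
    simp only [siteBalance2]
    ring
  have hlt : ∑ p, (supplyS NK N1 p u + T p u + meanProjS NK N1 u) <
      ∑ p, (lam1 * kappa1S NK N1 p u + lam3 * kappa3S NK N1 p u + readoutS NK N1 p u) := by
    rw [h1, hT]; linarith
  obtain ⟨p, -, hp⟩ := Finset.exists_lt_of_sum_lt hlt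
  exact ⟨p, hp⟩

/-- **No zero-sum transfer family makes the `(λ₁, λ₃)`-scaled sitewise LMI hold** once a field with negative site sum exists. [folklore] -/
theorem not_jointLMI2_of_siteSum_neg (lam1 lam3 : ℚ) (u : Fin (dimG NK N1) → ℚ)
    (hneg : ∑ p, siteBalance2 NK N1 lam1 lam3 p u < 0)
    (T : SiteG NK N1 → (Fin (dimG NK N1) → ℚ) → ℚ) (hT : ∑ p, T p u = 0) :
    ¬ ∀ (p : SiteG NK N1) (v : Fin (dimG NK N1) → ℚ), lam1 * kappa1S NK N1 p v + lam3 * kappa3S NK N1 p v + readoutS NK N1 p v ≤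
        supplyS NK N1 p v + T p v + meanProjS NK N1 v := by
  intro h
  obtain ⟨p, hp⟩ := exists_deficit2_of_siteSum_neg NK N1 lam1 lam3 u T hT hneg
  exact absurd (h p u) (not_le.mpr hp)

/-! ### Evaluator (split κ) -/

/-- κ₁-demand of site `p` from the κ plan. [folklore] -/
def evalKappa1 (plan : List (Off × ℚ × ℚ × ℚ)) (p : SiteG NK N1) (t0 t1 t2 : ℚ) (u : Fin (dimG NK N1) → ℚ) : ℚ :=
  (plan.map fun r =>
    let v := bondVals NK N1 u p (taddG NK N1 p r.1) t0 t1 t2 r.2.1 r.2.2.1 r.2.2.2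
    kappa1 * v.2 ^ 2).sum

/-- κ₃-demand of site `p` from the κ plan. [folklore] -/
def evalKappa3 (plan : List (Off × ℚ × ℚ × ℚ)) (p : SiteG NK N1) (t0 t1 t2 : ℚ) (u : Fin (dimG NK N1) → ℚ) : ℚ :=
  (plan.map fun r =>
    let v := bondVals NK N1 u p (taddG NK N1 p r.1) t0 t1 t2 r.2.1 r.2.2.1 r.2.2.2
    kappa3 * v.1).sum

/-- `kappa1S` from the κ plan. [folklore] -/
theorem kappa1S_eq_eval (p : SiteG NK N1) (u : Fin (dimG NK N1) → ℚ) :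
    kappa1S NK N1 p u = evalKappa1 NK N1 (kappaPlan (parityG NK N1 p)) p (thetaVal NK N1 p u 0) (thetaVal NK N1 p u 1)
      (thetaVal NK N1 p u 2) u := by
  simp only [kappa1S, kappa1TermsG, evalKappa1, kappaPlan, evalQ_flatMapN, List.map_map]
  congr 1
  refine List.map_congr_left fun s _ => ?_
  simp only [Function.comp, evalQ_cons, evalQ_nil, sqN, eval_dotGN_eRelG, bondVals_eq]
  ring

/-- `kappa3S` from the κ plan. [folklore] -/
theorem kappa3S_eq_eval (p : SiteG NK N1) (u : Fin (dimG NK N1) → ℚ) :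
    kappa3S NK N1 p u = evalKappa3 NK N1 (kappaPlan (parityG NK N1 p)) p (thetaVal NK N1 p u 0) (thetaVal NK N1 p u 1)
      (thetaVal NK N1 p u 2) u := by
  simp only [kappa3S, kappa3TermsG, evalKappa3, kappaPlan, evalQ_flatMapN, List.map_map]
  congr 1
  refine List.map_congr_left fun s _ => ?_
  simp only [Function.comp, evalQ_cons, evalQ_nil, sqN, eval_residG, thetaVal, bondVals_eq]
  ring

/-- **Whole-torus two-parameter balance** evaluated from the plans. [folklore] -/
def torusBalance2 (lam1 lam3 : ℚ) (u : Fin (dimG NK N1) → ℚ) : ℚ :=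
  let spA := supplyPlan true
  let spB := supplyPlan false
  let kpA := kappaPlan true
  let kpB := kappaPlan false
  let rpA := readoutPlan true betaTable
  let rpB := readoutPlan false betaTable
  let tpA := thetaPlan true
  let tpB := thetaPlan false
  let mp := meanProjS NK N1 u
  ((allSitesG NK N1).map fun p =>
    let b := parityG NK N1 p
    let t0 := thetaFast NK N1 (if b = true then tpA else tpB) p u 0
    let t1 := thetaFast NK N1 (if b = true then tpA else tpB) p u 1
    let t2 := thetaFast NK N1 (if b = true then tpA else tpB) p u 2
    evalSupply NK N1 (if b = true then spA else spB) p t0 t1 t2 u + mp -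
      lam1 * evalKappa1 NK N1 (if b = true then kpA else kpB) p t0 t1 t2 u -
      lam3 * evalKappa3 NK N1 (if b = true then kpA else kpB) p t0 t1 t2 u -
      evalReadout NK N1 (if b = true then rpA else rpB) p t0 t1 t2 u).sum

/-- **The evaluator IS the two-parameter site-balance sum.** [folklore] -/
theorem torusBalance2_eq (lam1 lam3 : ℚ) (u : Fin (dimG NK N1) → ℚ) :
    ∑ p : SiteG NK N1, siteBalance2 NK N1 lam1 lam3 p u = torusBalance2 NK N1 lam1 lam3 u := by
  rw [← allSitesG_sum, torusBalance2]
  congr 1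
  refine List.map_congr_left fun p _ => ?_
  obtain ⟨h0, h1, h2⟩ := thetaVal_eq_fast NK N1 p u
  simp only [if_parity_eq (parityG NK N1 p) supplyPlan, if_parity_eq (parityG NK N1 p) kappaPlan,
    if_parity_eq (parityG NK N1 p) (fun b => readoutPlan b betaTable), if_parity_eq (parityG NK N1 p) thetaPlan,
    siteBalance2, supplyS_eq_eval, kappa1S_eq_eval, kappa3S_eq_eval, readoutS_eq_eval, h0, h1, h2]

/-- A negative evaluator value certifies a negative two-parameter site-balance sum. [folklore] -/
theorem siteSum2_neg_of_torusBalance2_neg (lam1 lam3 : ℚ) (u : Fin (dimG NK N1) → ℚ)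
    (h : torusBalance2 NK N1 lam1 lam3 u < 0) : ∑ p : SiteG NK N1, siteBalance2 NK N1 lam1 lam3 p u < 0 := by
  rwa [torusBalance2_eq]

end Shape

end Summit.AtomisticToContinuum.Crystallization.Theorems.StrictSplittingRuleTorusLMI
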